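import Literature.NumberTheory.NumberFields.QuadraticSqrtTwoClassNumberNotDvdFour
import Literature.NumberTheory.NumberFields.QuadraticSqrtTwoNormTwoPrimeCertificate
import Literature.NumberTheory.IwasawaTheory.ClassGroupPRankLayerOneGenusJump
import Literature.NumberTheory.IwasawaTheory.ClassicalMuVanishesUnitNormIndex
import Literature.NumberTheory.IwasawaTheory.CyclotomicTwoTotallyRamifiedNoSqrtTwo
import Literature.NumberTheory.IwasawaTheory.ClassGroupPRankLeOneOfAmbiguousLayerTwoOddIndex
import HarnessLib

/-!
# `e₁ = 1` FROM THE BASE FIELD: `ord₂ h(K_1) = 1` for the first layer `K_1 = K(√2)` of the cyclotomic `ℤ₂`-extension of an odd-degree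
# field `K` with `2 ∤ d_K`, `h_K` odd, at most two primes above `2`, a dyadic prime `𝔭₁` of norm `2`, all units `≡ ±1 (mod 𝔭₁³)`, and a
# dyadic prime power `𝔭₂^k = (π)` with `π ≡ ±3 (mod 𝔭₁³)` — and THE DEPTH DOOR WITH `e₁ ≤ 1` DISCHARGED

`Proofs`-style file (theorems only: no definition, no named fact, no instance, no `sorry`) in topic `NumberTheory/IwasawaTheory` (namespace = path),
written by the prover seat `bsd-line-att-p3` g43 (cell `bsd-f1-sign2`, route `AlignedTransportAtTwo`; `--supports` stmt-BirchSwinnertonDyer-22298, closes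
nothing).  It is the `ℤ₂`-tower packaging of this seat's genus-character certificate (`NumberFields/QuadraticSqrtTwoClassNumberNotDvdFour`): the datum
`classNumberPExp κ 1 ≤ 1` of the depth door (`ClassGroupPRankLeOneOfAmbiguousLayerTwo{,OddIndex}`, att-p3 g42) — the only hypothesis of that door about
the SEXTIC field `K_1` — becomes congruences in `𝓞_K`.

* `Ideal.map_eq_sq_of_sq_eq_two` — `L/K` Galois of degree `2` with `√2 ∈ L`, `𝔭 ∋ 2` a prime of `K` with `2 ∉ 𝔭²`, `P ∣ 𝔭` ⟹ `𝔭𝓞_L = P²`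
  (`e(P|𝔭) = 2`, one prime above `𝔭`: att-p3 g41's `ramificationIdx_eq_two_of_sq_eq_two`).
* `natCard_quotient_le_two_of_classGroupPRank_le_one` — `rank₂ Cl(K_n) ≤ 1 ⟹ #(Cl(K_n)/Cl(K_n)²) ≤ 2` (the quotient is an elementary `2`-group).
* `forall_algebraMap_ne_of_sq_eq_two` — `√2 ∉ K` for `2 ∤ d_K` (odd `e(w|2)`; tree `forall_sq_ne_two_of_forall_odd_ramificationIdx`).
* ★★★ `classNumberPExp_one_eq_one_of_genusCert` — `K` with `2 ∤ [K:ℚ]`, `2 ∤ d_K`, `h_K` odd, at most two primes above `2`, `κ` cyclotomic; `𝔭₁` with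
  `N𝔭₁ = 2`; every unit `≡ ±1 (mod 𝔭₁³)`; `𝔭₂ ∋ 2` prime with `𝔭₂^k = (π)`, `π ≡ ±3 (mod 𝔭₁³)` ⟹ **`classNumberPExp κ 1 = 1`** (`K_1 ∋ √2`, `[K_1:K] = 2`; Gras:
  `r₁ + 1 + ord₂[E:E∩N] = t₁ ≤ 2` so `r₁ ≤ 1`; `𝔭₂𝓞_{K_1} = P²`, `𝔔 = P^k`; then the certificate theorem).
* ★★ `classNumberPExp_one_eq_one_of_genusCert_of_rank_eq_one` — the same with the unit hypothesis discharged from unit rank `1` and ONE unit `ε ≡ ±1 (mod 𝔭₁³)`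
  with `±ε` non-squares (complex cubic fields).
* ★★★ `classGroupPRank_le_one_of_relIndex_unitsNorm_eq_one_of_genusCert` — att-p3 g42's DEPTH DOOR (`…_of_not_dvd_discr`) with `he1` DISCHARGED: exactly two
  primes above `2`, the genus certificate, and `[E_K : E_K ∩ N_{K_2/K} K_2ˣ] = 1` ⟹ `rank₂ Cl(K_m) ≤ 1 ∀ m`, `μ₂ = 0`, `λ₂ ≤ 1`.

CELL READING (crux C2, sub-cell `Δ_min ≡ 5 (mod 8)`: `K = ℚ(β)` complex cubic, `2 = 𝔭₁𝔭₂`, `f(𝔭₁|2) = 1`, `f(𝔭₂|2) = 2`, `h_K = 1`): `π = π₂` a generator of `𝔭₂`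
(`k = 1`), the certificate is `π₂ ≡ ±3 (mod 𝔭₁³)` — the kernel form of att-p3 g41's census predictor «`σ₁(π₁)/2 ≡ ±3 (mod 8)`» —, and on the classes u1/u7
(`σ₁(ε) ≡ ±1 (mod 8)`) the unit hypothesis holds by definition.  Nothing about any seed is asserted here; BSD is not advanced by this file.

References: [Gras2003] IV.4; [Washington1997] §13.1 Prop. 13.2, §13.3 Prop. 13.22; [Fukuda1994] Thm. 1; [Serre1973CourseArithmetic] Ch. III §1.2 Thm. 1;
[NeukirchANT1999] Ch. I §8 Prop. (8.2), Ch. III §1 (1.6); [Lang1990] Ch. 13 §4 Lemma 4.1.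
-/

set_option autoImplicit false

noncomputable section

open scoped NumberField nonZeroDivisors
open NumberField IsDedekindDomain

namespace Literature.NumberTheory.IwasawaTheory

open Literature.NumberTheory.EllipticCurves Literature.NumberTheory.NumberFields Literature.NumberTheory.NumberFields.AmbiguousClass
  Literature.NumberTheory.GaloisRepresentations Literature.NumberTheory.GaloisRepresentations.Herbrand
  Literature.NumberTheory.GaloisRepresentations.MinkowskiUnit Literature.NumberTheory.GaloisRepresentations.CyclicNormIndex

/-! ## §1 Three bookkeeping lemmas -/

section Bookkeeping

variable {K L : Type} [Field K] [NumberField K] [Field L] [NumberField L] [Algebra K L]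

/-- **`𝔭𝓞_L = P²`** for `L/K` Galois of degree `2` containing `s` with `s² = 2`, a prime `𝔭 ∋ 2` of `K` with `2 ∉ 𝔭²`, and `P` a prime of `L` above `𝔭`:
`e(P|𝔭) = 2` and `P` is the only prime above `𝔭` (att-p3 g41's `ramificationIdx_eq_two_of_sq_eq_two`), so the prime factorisation of `𝔭𝓞_L` is `P²`.
[cite: NeukirchANT1999, Ch. I §8 Prop. (8.2) (`𝔭𝒪 = ∏ 𝔓ᵢ^{eᵢ}`)] [cite: Washington1997, §13.1 Prop. 13.2] -/
theorem Ideal.map_eq_sq_of_sq_eq_two [IsGalois K L] (h2 : Module.finrank K L = 2) {s : L} (hs : s ^ 2 = 2)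
    (𝔭 : Ideal (𝓞 K)) [𝔭.IsMaximal] (h2𝔭 : (2 : 𝓞 K) ∈ 𝔭) (hunr : (2 : 𝓞 K) ∉ 𝔭 ^ 2)
    (P : Ideal (𝓞 L)) [P.IsPrime] [hP : P.LiesOver 𝔭] :
    𝔭.map (algebraMap (𝓞 K) (𝓞 L)) = P ^ 2 := by
  classical
  obtain ⟨he, hone, -⟩ := ramificationIdx_eq_two_of_sq_eq_two h2 hs 𝔭 h2𝔭 hunr P
  have h𝔭0 : 𝔭 ≠ ⊥ := fun h => by
    rw [h, Submodule.mem_bot] at h2𝔭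
    exact two_ne_zero h2𝔭
  set I := 𝔭.map (algebraMap (𝓞 K) (𝓞 L)) with hI
  have hI0 : I ≠ ⊥ := Ideal.map_ne_bot_of_ne_bot h𝔭0
  have hP0 : P ≠ ⊥ := Ideal.ne_bot_of_liesOver_of_ne_bot h𝔭0 P
  -- every prime factor of `I` lies over `𝔭`, hence equals `P`
  have hmem : ∀ Q ∈ UniqueFactorizationMonoid.normalizedFactors I, Q = P := by
    intro Q hQ
    have hQprime : Q.IsPrime := Ideal.isPrime_of_prime (UniqueFactorizationMonoid.prime_of_normalized_factor Q hQ)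
    have hle : I ≤ Q := Ideal.le_of_dvd (UniqueFactorizationMonoid.dvd_of_mem_normalizedFactors hQ)
    have hunder : Q.under (𝓞 K) = 𝔭 := by
      refine ((inferInstance : 𝔭.IsMaximal).eq_of_le (Ideal.IsPrime.ne_top inferInstance) ?_).symm
      rw [Ideal.under_def, ← Ideal.map_le_iff_le_comap]
      exact hle
    haveI : Q.LiesOver 𝔭 := ⟨hunder.symm⟩
    have hQmem : Q ∈ 𝔭.primesOver (𝓞 L) := ⟨hQprime, inferInstance⟩
    have hPmem : P ∈ 𝔭.primesOver (𝓞 L) := ⟨inferInstance, hP⟩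
    obtain ⟨R, hR⟩ := Set.ncard_eq_one.mp hone
    rw [hR, Set.mem_singleton_iff] at hQmem hPmem
    rw [hQmem, hPmem]
  have hcount : Multiset.count P (UniqueFactorizationMonoid.normalizedFactors I) = 2 := by
    rw [← he, hI, Ideal.IsDedekindDomain.ramificationIdx_eq_normalizedFactors_count 𝔭 P hI0]
  have hrep : UniqueFactorizationMonoid.normalizedFactors I = Multiset.replicate 2 P := by
    rw [Multiset.eq_replicate]
    refine ⟨?_, hmem⟩
    rw [← hcount, eq_comm, Multiset.count_eq_card]
    intro Q hQ
    exact (hmem Q hQ).symm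
  rw [← Ideal.prod_normalizedFactors_eq_self hI0, hrep, Multiset.prod_replicate]

end Bookkeeping

variable {K : Type} [Field K] [NumberField K]

omit [NumberField K] in
/-- **`rank₂ Cl(K_n) ≤ 1 ⟹ #(Cl(K_n)/Cl(K_n)²) ≤ 2`**: the quotient `Cl/Cl²` is an elementary abelian `2`-group, so its order is `2^{rank₂}`.
[cite: Fukuda1994, p. 264 (definition of `rank(M)` as `dim M/pM`)] -/
theorem natCard_quotient_le_two_of_classGroupPRank_le_one (κ : ZpExtension K 2) (n : ℕ) [NumberField (κ.layer n)]
    (h : classGroupPRank κ n ≤ 1) :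
    Nat.card (ClassGroup (𝓞 (κ.layer n)) ⧸
      (powMonoidHom 2 : ClassGroup (𝓞 (κ.layer n)) →* ClassGroup (𝓞 (κ.layer n))).range) ≤ 2 := by
  haveI : Fact (Nat.Prime 2) := ⟨Nat.prime_two⟩
  set G := ClassGroup (𝓞 (κ.layer n))
  have hP : IsPGroup 2 (G ⧸ (powMonoidHom 2 : G →* G).range) := by
    intro g
    obtain ⟨x, rfl⟩ := QuotientGroup.mk_surjective g
    refine ⟨1, ?_⟩
    rw [pow_one, ← QuotientGroup.mk_pow, QuotientGroup.eq_one_iff]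
    exact ⟨x, rfl⟩
  obtain ⟨m, hm⟩ := (IsPGroup.iff_card).mp hP
  rw [classGroupPRank_def] at h
  change padicValNat 2 (Nat.card (G ⧸ (powMonoidHom 2 : G →* G).range)) ≤ 1 at h
  rw [hm, padicValNat.prime_pow] at h
  rw [hm]
  calc 2 ^ m ≤ 2 ^ 1 := Nat.pow_le_pow_right (by norm_num) h
    _ = 2 := pow_one 2

/-- **`√2 ∉ K` when `2 ∤ d_K`** (every `e(w|2) = 1` is odd; tree `forall_sq_ne_two_of_forall_odd_ramificationIdx`), in the form
`algebraMap K L k ≠ s` for any `K`-algebra `L ∋ s` with `s² = 2`. [cite: NeukirchANT1999, Ch. III (2.12) and Ch. I §8] -/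
theorem forall_algebraMap_ne_of_sq_eq_two (hd : ¬ (2 : ℤ) ∣ NumberField.discr K) {L : Type*} [Field L] [Algebra K L]
    {s : L} (hs : s ^ 2 = 2) : ∀ k : K, algebraMap K L k ≠ s := by
  intro k hk
  have hk2 : k ^ 2 = 2 := by
    apply (algebraMap K L).injective
    rw [map_pow, hk, hs, map_ofNat]
  exact forall_sq_ne_two_of_forall_odd_ramificationIdx (forall_odd_ramificationIdx_of_not_dvd_discr hd) k hk2

/-! ## §2 `e₁ = 1` from the base-field certificate -/

/-- ★★★ **`ord₂ h(K_1) = 1` from the genus-character certificate in `K`.**  `K` a number field with `2 ∤ [K:ℚ]`, `2 ∤ d_K`, `h_K` odd and at most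
two primes above `2`; `κ` a cyclotomic `ℤ₂`-extension; `𝔭₁` an ideal of `𝓞_K` of norm `2`; every unit of `K` congruent to `±1 (mod 𝔭₁³)`; `𝔭₂ ∋ 2` a prime of
`𝓞_K` with `𝔭₂^k = (π)` and `π ≡ ±3 (mod 𝔭₁³)`.  THEN `classNumberPExp κ 1 = 1`.  (`K_1 ∋ √2 ∉ K`, `[K_1:K] = 2`; Gras IV.4: `rank₂ Cl(K_1) + 1 + ord₂[E_K : E_K ∩ N K_1ˣ]
= #{ramified} ≤ #{w ∣ 2} ≤ 2`; `𝔭₂𝓞_{K_1} = P²`, `𝔔 = P^k` has `𝔔² = π𝓞_{K_1}`; then `padicValNat_two_card_classGroup_eq_one_of_genusCert`.)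
[cite: Gras2003, IV.4] [cite: Washington1997, §13.1 Prop. 13.2] [cite: Serre1973CourseArithmetic, Ch. III §1.2, Thm. 1] [cite: NeukirchANT1999, Ch. III §1 (1.6)] -/
theorem classNumberPExp_one_eq_one_of_genusCert (hK : ¬ 2 ∣ Module.finrank ℚ K) (hd : ¬ (2 : ℤ) ∣ NumberField.discr K)
    (hodd : Odd (classNumber K)) (κ : ZpExtension K 2) (hκ : κ.IsCyclotomic) [NumberField (κ.layer 1)]
    (h2le : {w : HeightOneSpectrum (𝓞 K) | ((2 : ℕ) : 𝓞 K) ∈ w.asIdeal}.ncard ≤ 2)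
    (𝔭₁ : Ideal (𝓞 K)) (hN : Ideal.absNorm 𝔭₁ = 2)
    (hunits : ∀ u : (𝓞 K)ˣ, (u : 𝓞 K) - 1 ∈ 𝔭₁ ^ 3 ∨ (u : 𝓞 K) + 1 ∈ 𝔭₁ ^ 3)
    (𝔭₂ : Ideal (𝓞 K)) [𝔭₂.IsPrime] (h𝔭₂ : (2 : 𝓞 K) ∈ 𝔭₂) {π : 𝓞 K} {k : ℕ} (hk : 𝔭₂ ^ k = Ideal.span {π})
    (hπ : π - 3 ∈ 𝔭₁ ^ 3 ∨ π + 3 ∈ 𝔭₁ ^ 3) :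
    classNumberPExp κ 1 = 1 := by
  classical
  haveI : Fact (Nat.Prime 2) := ⟨Nat.prime_two⟩
  haveI : FiniteDimensional K (κ.layer 1) := κ.finiteDimensional_layer_holds 1
  haveI : IsGalois K (κ.layer 1) := κ.isGalois_layer_holds 1
  have hdeg : Module.finrank K (κ.layer 1) = 2 := by rw [κ.finrank_layer_holds 1, pow_one]
  -- `√2 ∈ K_1 ∖ K`
  obtain ⟨s, hs⟩ := exists_sq_eq_two_layer_one_of_not_dvd_finrank hK κ hκ
  have hsK : ∀ x : K, algebraMap K (κ.layer 1) x ≠ s := forall_algebraMap_ne_of_sq_eq_two hd hs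
  -- the dyadic prime `𝔭₁` of norm `2`
  obtain ⟨h𝔭₁, hP0, h2P, hcard⟩ := isPrime_and_mem_of_absNorm_eq_two 𝔭₁ hN
  haveI := h𝔭₁
  haveI : 𝔭₁.IsMaximal := h𝔭₁.isMaximal hP0
  have hres := forall_mem_or_sub_one_mem_of_card_quotient_eq_two 𝔭₁ hcard
  have h2P' : (2 : 𝓞 K) ∉ 𝔭₁ ^ 2 := two_not_mem_sq_of_not_dvd_discr hd 𝔭₁ h2P
  -- `rank₂ Cl(K_1) ≤ 1` by genus theory
  have hgras := classGroupPRank_one_add_one_add_padicValNat_eq_ncard κ hodd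
  have ht := ncard_ramified_layer_le_of_ncard_eq κ 1 (s := {w : HeightOneSpectrum (𝓞 K) | ((2 : ℕ) : 𝓞 K) ∈ w.asIdeal}.ncard) rfl
  have hr1 : classGroupPRank κ 1 ≤ 1 := by omega
  have hrank := natCard_quotient_le_two_of_classGroupPRank_le_one κ 1 hr1
  -- `𝔭₂ 𝓞_{K_1} = P²`, `𝔔 = P^k`, `𝔔² = π 𝓞_{K_1}`
  haveI : 𝔭₂.IsMaximal := Ideal.IsPrime.isMaximal inferInstance fun h => by
    rw [h, Submodule.mem_bot] at h𝔭₂; exact two_ne_zero h𝔭₂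
  have hunr₂ : (2 : 𝓞 K) ∉ 𝔭₂ ^ 2 := two_not_mem_sq_of_not_dvd_discr hd 𝔭₂ h𝔭₂
  obtain ⟨⟨P, hPprime, hPover⟩⟩ := (inferInstance : Nonempty (𝔭₂.primesOver (𝓞 (κ.layer 1))))
  haveI := hPprime
  haveI := hPover
  have hmap := Ideal.map_eq_sq_of_sq_eq_two hdeg hs 𝔭₂ h𝔭₂ hunr₂ P
  have hQ : (P ^ k) ^ 2 = Ideal.span {algebraMap (𝓞 K) (𝓞 (κ.layer 1)) π} := by
    rw [← pow_mul, mul_comm, pow_mul, ← hmap, ← Ideal.map_pow, hk, Ideal.map_span, Set.image_singleton]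
  rw [classNumberPExp_def]
  exact padicValNat_two_card_classGroup_eq_one_of_genusCert hdeg hs hsK hodd 𝔭₁ hP0 hres h2P h2P' hunits hrank hπ hQ

/-- ★★ **The same for a field of unit rank one** (complex cubic fields): the unit hypothesis is discharged from `rank K = 1` and ONE unit `ε ≡ ±1 (mod 𝔭₁³)`
such that neither `ε` nor `−ε` is a square of a unit (this seat's `forall_units_sub_one_mem_or_add_one_mem_of_rank_eq_one`).
[cite: Gras2003, IV.4] [cite: NeukirchANT1999, Ch. I §7 Thm. (7.4)] [cite: Serre1973CourseArithmetic, Ch. III §1.2, Thm. 1] -/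
theorem classNumberPExp_one_eq_one_of_genusCert_of_rank_eq_one (hK : ¬ 2 ∣ Module.finrank ℚ K)
    (hd : ¬ (2 : ℤ) ∣ NumberField.discr K) (hodd : Odd (classNumber K)) (hrank : Units.rank K = 1)
    (κ : ZpExtension K 2) (hκ : κ.IsCyclotomic) [NumberField (κ.layer 1)]
    (h2le : {w : HeightOneSpectrum (𝓞 K) | ((2 : ℕ) : 𝓞 K) ∈ w.asIdeal}.ncard ≤ 2)
    (𝔭₁ : Ideal (𝓞 K)) (hN : Ideal.absNorm 𝔭₁ = 2) {ε : (𝓞 K)ˣ}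
    (hε : (ε : 𝓞 K) - 1 ∈ 𝔭₁ ^ 3 ∨ (ε : 𝓞 K) + 1 ∈ 𝔭₁ ^ 3) (hnsq : ∀ y : (𝓞 K)ˣ, ε ≠ y ^ 2 ∧ ε ≠ -y ^ 2)
    (𝔭₂ : Ideal (𝓞 K)) [𝔭₂.IsPrime] (h𝔭₂ : (2 : 𝓞 K) ∈ 𝔭₂) {π : 𝓞 K} {k : ℕ} (hk : 𝔭₂ ^ k = Ideal.span {π})
    (hπ : π - 3 ∈ 𝔭₁ ^ 3 ∨ π + 3 ∈ 𝔭₁ ^ 3) :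
    classNumberPExp κ 1 = 1 := by
  obtain ⟨h𝔭₁, hP0, h2P, hcard⟩ := isPrime_and_mem_of_absNorm_eq_two 𝔭₁ hN
  haveI := h𝔭₁
  haveI : 𝔭₁.IsMaximal := h𝔭₁.isMaximal hP0
  have hres := forall_mem_or_sub_one_mem_of_card_quotient_eq_two 𝔭₁ hcard
  have h2P' : (2 : 𝓞 K) ∉ 𝔭₁ ^ 2 := two_not_mem_sq_of_not_dvd_discr hd 𝔭₁ h2P
  have hoddK : Odd (Module.finrank ℚ K) := Nat.odd_iff.mpr (Nat.two_dvd_ne_zero.mp hK)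
  have hunits := forall_units_sub_one_mem_or_add_one_mem_of_rank_eq_one hoddK hrank 𝔭₁ hP0 hres h2P h2P' hε hnsq
  exact classNumberPExp_one_eq_one_of_genusCert hK hd hodd κ hκ h2le 𝔭₁ hN hunits 𝔭₂ h𝔭₂ hk hπ

/-! ## §3 The depth door with `e₁ ≤ 1` discharged -/

/-- ★★★ **THE DEPTH DOOR FROM BASE-FIELD DATA** (att-p3 g42's `classGroupPRank_le_one_of_relIndex_unitsNorm_eq_one_of_not_dvd_discr` ∘ §2).  `K` of odd
degree with `2 ∤ d_K`, `h_K` odd, EXACTLY two primes above `2`, `κ` cyclotomic; `𝔭₁` of norm `2`, every unit `≡ ±1 (mod 𝔭₁³)`, `𝔭₂ ∋ 2` prime with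
`𝔭₂^k = (π)`, `π ≡ ±3 (mod 𝔭₁³)`; and the unit norm index `[E_K : E_K ∩ N_{K_2/K} K_2ˣ] = 1` of the quartic layer.  THEN `rank₂ Cl(K_m) ≤ 1` for every `m`,
`μ₂(κ) = 0`, `λ₂(κ) ≤ 1`. [cite: Fukuda1994, Thm. 1, p. 264] [cite: Washington1997, §13.3 Prop. 13.22–13.23] [cite: Gras2003, IV.4]
[cite: Lang1990, Ch. 13 §4, Lemma 4.1 (PDF pp. 203–204)] -/
theorem classGroupPRank_le_one_of_relIndex_unitsNorm_eq_one_of_genusCert (hK : ¬ 2 ∣ Module.finrank ℚ K)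
    (hd : ¬ (2 : ℤ) ∣ NumberField.discr K) (hodd : Odd (classNumber K)) (κ : ZpExtension K 2) (hκ : κ.IsCyclotomic)
    [NumberField (κ.layer 1)] [NumberField (κ.layer 2)]
    (h2eq : {w : HeightOneSpectrum (𝓞 K) | ((2 : ℕ) : 𝓞 K) ∈ w.asIdeal}.ncard = 2)
    (𝔭₁ : Ideal (𝓞 K)) (hN : Ideal.absNorm 𝔭₁ = 2)
    (hunits : ∀ u : (𝓞 K)ˣ, (u : 𝓞 K) - 1 ∈ 𝔭₁ ^ 3 ∨ (u : 𝓞 K) + 1 ∈ 𝔭₁ ^ 3)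
    (𝔭₂ : Ideal (𝓞 K)) [𝔭₂.IsPrime] (h𝔭₂ : (2 : 𝓞 K) ∈ 𝔭₂) {π : 𝓞 K} {k : ℕ} (hk : 𝔭₂ ^ k = Ideal.span {π})
    (hπ : π - 3 ∈ 𝔭₁ ^ 3 ∨ π + 3 ∈ 𝔭₁ ^ 3)
    (hidx : (unitsE (κ.layer 2) ⊓ (⊤ : Subgroup (κ.layer 2)ˣ).map
        (Herbrand.norm ((κ.layer 2) ≃ₐ[K] (κ.layer 2)))).relIndex
        (unitsE (κ.layer 2) ⊓ (unitsIncl K (κ.layer 2)).range) = 1) :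
    (∀ m, classGroupPRank κ m ≤ 1) ∧ ClassicalMuVanishes κ ∧ classicalLambda κ ≤ 1 := by
  have he1 : classNumberPExp κ 1 ≤ 1 :=
    (classNumberPExp_one_eq_one_of_genusCert hK hd hodd κ hκ h2eq.le 𝔭₁ hN hunits 𝔭₂ h𝔭₂ hk hπ).le
  have hh : ¬ 2 ∣ classNumber K := fun h => (Nat.not_even_iff_odd.mpr hodd) (even_iff_two_dvd.mpr h)
  exact classGroupPRank_le_one_of_relIndex_unitsNorm_eq_one_of_not_dvd_discr hK hd κ hκ hh he1 h2eq.ge hidx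

/-! ## §4 The «odd» certificate (the genus regime where `𝔓₂` is principal) — appended by the same seat (att-p3 g43)

When `𝔓₂` is principal (the regime in which `ε` is NOT the norm of a unit of `K_1`) the class of order `2` of `Cl(K_1)` contains no ambiguous ideal and §2
never fires.  The general certificate of `NumberFields/QuadraticSqrtTwoClassNumberNotDvdFour` §6 takes ANY ideal `𝔔` with `𝔔²` principal and `N(𝔔) = (α)`,
`α ≡ ±3 (mod 𝔭₁³)`; here it is fed with `𝔔 = (x + y√2, α)` built from BASE-FIELD data: `x, y, α ∈ 𝓞_K`, a unit `u`, with `x² − 2y² = uα²`, Bézout witnesses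
`mα + nx = 1`, `m'α² + 2n' = 1` (so `𝔔² = (x + y√2)`, `N(𝔔) = (α)`; typically `(α) = 𝔮` a prime of `K` split in `K(√2)` whose prime divisor in `K_1` has
order `2` in `Cl(K_1)`). -/

/-- ★★★ **`ord₂ h(K_1) = 1` from the ODD genus certificate in `K`.**  `K` with `2 ∤ [K:ℚ]`, `2 ∤ d_K`, `h_K` odd, at most two primes above `2`; `κ` a cyclotomic
`ℤ₂`-extension; `𝔭₁` of norm `2`; every unit `≡ ±1 (mod 𝔭₁³)`; and `x, y, α, m, n, m', n' ∈ 𝓞_K`, a unit `u`, with `x² − 2y² = u·α²`, `mα + nx = 1`, `m'α² + 2n' = 1`,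
`α ≡ ±3 (mod 𝔭₁³)`.  THEN `classNumberPExp κ 1 = 1`.  (`δ = x + y√2 ∈ 𝓞_{K_1}` has `N(δ) = uα²`, `2xδ = δ² + N(δ)`; `𝔔 = (δ, α)` has `𝔔² = (δ)`, `N(𝔔) = (α)`;
then `padicValNat_two_card_classGroup_eq_one_of_genusCert_of_relNorm_eq`.) [cite: Gras2003, IV.4] [cite: Serre1973CourseArithmetic, Ch. III §1.2, Thm. 1]
[cite: NeukirchANT1999, Ch. I §3 and Ch. III §1 (1.6)] [cite: Washington1997, §13.1 Prop. 13.2] -/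
theorem classNumberPExp_one_eq_one_of_genusCert_odd (hK : ¬ 2 ∣ Module.finrank ℚ K) (hd : ¬ (2 : ℤ) ∣ NumberField.discr K)
    (hodd : Odd (classNumber K)) (κ : ZpExtension K 2) (hκ : κ.IsCyclotomic) [NumberField (κ.layer 1)]
    (h2le : {w : HeightOneSpectrum (𝓞 K) | ((2 : ℕ) : 𝓞 K) ∈ w.asIdeal}.ncard ≤ 2)
    (𝔭₁ : Ideal (𝓞 K)) (hN : Ideal.absNorm 𝔭₁ = 2)
    (hunits : ∀ u : (𝓞 K)ˣ, (u : 𝓞 K) - 1 ∈ 𝔭₁ ^ 3 ∨ (u : 𝓞 K) + 1 ∈ 𝔭₁ ^ 3)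
    {x y α m n m' n' : 𝓞 K} {u : (𝓞 K)ˣ} (hxy : x ^ 2 - 2 * y ^ 2 = (u : 𝓞 K) * α ^ 2)
    (hbez : m * α + n * x = 1) (hbez' : m' * α ^ 2 + n' * 2 = 1)
    (hα : α - 3 ∈ 𝔭₁ ^ 3 ∨ α + 3 ∈ 𝔭₁ ^ 3) :
    classNumberPExp κ 1 = 1 := by
  classical
  haveI : Fact (Nat.Prime 2) := ⟨Nat.prime_two⟩
  haveI : FiniteDimensional K (κ.layer 1) := κ.finiteDimensional_layer_holds 1
  haveI : IsGalois K (κ.layer 1) := κ.isGalois_layer_holds 1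
  have hdeg : Module.finrank K (κ.layer 1) = 2 := by rw [κ.finrank_layer_holds 1, pow_one]
  -- `√2 ∈ 𝓞_{K_1} ∖ K`
  obtain ⟨s, hs⟩ := exists_sq_eq_two_layer_one_of_not_dvd_finrank hK κ hκ
  have hsK : ∀ x : K, algebraMap K (κ.layer 1) x ≠ s := forall_algebraMap_ne_of_sq_eq_two hd hs
  have hsint : IsIntegral ℤ s := by
    refine ⟨Polynomial.X ^ 2 - Polynomial.C 2, Polynomial.monic_X_pow_sub_C _ two_ne_zero, ?_⟩
    simp [hs]
  set s' : 𝓞 (κ.layer 1) := ⟨s, hsint⟩ with hs'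
  have hs'2 : s' ^ 2 = 2 := by
    apply Subtype.ext
    change ((s' ^ 2 : 𝓞 (κ.layer 1)) : κ.layer 1) = ((2 : 𝓞 (κ.layer 1)) : κ.layer 1)
    push_cast
    exact hs
  -- the dyadic prime `𝔭₁` of norm `2`
  obtain ⟨h𝔭₁, hP0, h2P, hcard⟩ := isPrime_and_mem_of_absNorm_eq_two 𝔭₁ hN
  haveI := h𝔭₁
  haveI : 𝔭₁.IsMaximal := h𝔭₁.isMaximal hP0
  have hres := forall_mem_or_sub_one_mem_of_card_quotient_eq_two 𝔭₁ hcard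
  have h2P' : (2 : 𝓞 K) ∉ 𝔭₁ ^ 2 := two_not_mem_sq_of_not_dvd_discr hd 𝔭₁ h2P
  -- `rank₂ Cl(K_1) ≤ 1` by genus theory
  have hgras := classGroupPRank_one_add_one_add_padicValNat_eq_ncard κ hodd
  have ht := ncard_ramified_layer_le_of_ncard_eq κ 1 (s := {w : HeightOneSpectrum (𝓞 K) | ((2 : ℕ) : 𝓞 K) ∈ w.asIdeal}.ncard) rfl
  have hr1 : classGroupPRank κ 1 ≤ 1 := by omega
  have hrank := natCard_quotient_le_two_of_classGroupPRank_le_one κ 1 hr1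
  -- the ideal `𝔔 = (δ, α)`, `δ = x + y s'`
  set f := algebraMap (𝓞 K) (𝓞 (κ.layer 1)) with hf
  set δ : 𝓞 (κ.layer 1) := f x + f y * s' with hδ
  have hcoe : ∀ z : 𝓞 K, algebraMap (𝓞 (κ.layer 1)) (κ.layer 1) (f z) = algebraMap K (κ.layer 1) (z : K) := fun z => by
    rw [RingOfIntegers.coe_eq_algebraMap, hf]
    exact (IsScalarTower.algebraMap_apply (𝓞 K) (𝓞 (κ.layer 1)) (κ.layer 1) z).symm.trans
      (IsScalarTower.algebraMap_apply (𝓞 K) K (κ.layer 1) z)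
  have hcoes : algebraMap (𝓞 (κ.layer 1)) (κ.layer 1) s' = s := rfl
  have hcoeδ : (δ : κ.layer 1) = algebraMap K (κ.layer 1) (x : K) + algebraMap K (κ.layer 1) (y : K) * s := by
    rw [RingOfIntegers.coe_eq_algebraMap, hδ, map_add, map_mul, hcoe, hcoe, hcoes]
  have hNδ : Algebra.intNorm (𝓞 K) (𝓞 (κ.layer 1)) δ = (u : 𝓞 K) * α ^ 2 := by
    have h1 : ((Algebra.intNorm (𝓞 K) (𝓞 (κ.layer 1)) δ : 𝓞 K) : K) = Algebra.norm K (δ : κ.layer 1) :=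
      Algebra.algebraMap_intNorm (A := 𝓞 K) (K := K) (L := κ.layer 1) (B := 𝓞 (κ.layer 1)) δ
    apply RingOfIntegers.coe_injective
    show ((Algebra.intNorm (𝓞 K) (𝓞 (κ.layer 1)) δ : 𝓞 K) : K) = ((((u : 𝓞 K) * α ^ 2 : 𝓞 K)) : K)
    rw [h1, hcoeδ, Algebra.norm_add_mul_eq_sq_sub_two_mul_sq hdeg hs hsK, ← hxy]
    push_cast
    simp only [RingOfIntegers.coe_eq_algebraMap, map_ofNat]
  have htr : 2 * f x * δ = δ ^ 2 + f (Algebra.intNorm (𝓞 K) (𝓞 (κ.layer 1)) δ) := by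
    rw [hNδ, ← hxy, map_sub, map_mul, map_pow, map_pow, map_ofNat, hδ]
    linear_combination (-(f y) ^ 2) * hs'2
  obtain ⟨hQ2, hNQ⟩ := sq_span_pair_eq_and_relNorm_eq (K := K) (L := κ.layer 1) hNδ rfl htr hbez hbez'
  rw [classNumberPExp_def]
  exact padicValNat_two_card_classGroup_eq_one_of_genusCert_of_relNorm_eq hdeg hs hsK hodd 𝔭₁ hP0 hres h2P h2P' hunits hrank hα hNQ
    ⟨⟨δ, by rw [hQ2, Ideal.submodule_span_eq]⟩⟩

/-- ★★ **The odd certificate for a field of unit rank one** (complex cubic fields): the unit hypothesis from `rank K = 1` and ONE unit `ε ≡ ±1 (mod 𝔭₁³)` with `±ε`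
non-squares. [cite: Gras2003, IV.4] [cite: NeukirchANT1999, Ch. I §7 Thm. (7.4)] [cite: Serre1973CourseArithmetic, Ch. III §1.2, Thm. 1] -/
theorem classNumberPExp_one_eq_one_of_genusCert_odd_of_rank_eq_one (hK : ¬ 2 ∣ Module.finrank ℚ K)
    (hd : ¬ (2 : ℤ) ∣ NumberField.discr K) (hodd : Odd (classNumber K)) (hrank : Units.rank K = 1)
    (κ : ZpExtension K 2) (hκ : κ.IsCyclotomic) [NumberField (κ.layer 1)]
    (h2le : {w : HeightOneSpectrum (𝓞 K) | ((2 : ℕ) : 𝓞 K) ∈ w.asIdeal}.ncard ≤ 2)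
    (𝔭₁ : Ideal (𝓞 K)) (hN : Ideal.absNorm 𝔭₁ = 2) {ε : (𝓞 K)ˣ}
    (hε : (ε : 𝓞 K) - 1 ∈ 𝔭₁ ^ 3 ∨ (ε : 𝓞 K) + 1 ∈ 𝔭₁ ^ 3) (hnsq : ∀ z : (𝓞 K)ˣ, ε ≠ z ^ 2 ∧ ε ≠ -z ^ 2)
    {x y α m n m' n' : 𝓞 K} {u : (𝓞 K)ˣ} (hxy : x ^ 2 - 2 * y ^ 2 = (u : 𝓞 K) * α ^ 2)
    (hbez : m * α + n * x = 1) (hbez' : m' * α ^ 2 + n' * 2 = 1)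
    (hα : α - 3 ∈ 𝔭₁ ^ 3 ∨ α + 3 ∈ 𝔭₁ ^ 3) :
    classNumberPExp κ 1 = 1 := by
  obtain ⟨h𝔭₁, hP0, h2P, hcard⟩ := isPrime_and_mem_of_absNorm_eq_two 𝔭₁ hN
  haveI := h𝔭₁
  haveI : 𝔭₁.IsMaximal := h𝔭₁.isMaximal hP0
  have hres := forall_mem_or_sub_one_mem_of_card_quotient_eq_two 𝔭₁ hcard
  have h2P' : (2 : 𝓞 K) ∉ 𝔭₁ ^ 2 := two_not_mem_sq_of_not_dvd_discr hd 𝔭₁ h2P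
  have hoddK : Odd (Module.finrank ℚ K) := Nat.odd_iff.mpr (Nat.two_dvd_ne_zero.mp hK)
  have hunits := forall_units_sub_one_mem_or_add_one_mem_of_rank_eq_one hoddK hrank 𝔭₁ hP0 hres h2P h2P' hε hnsq
  exact classNumberPExp_one_eq_one_of_genusCert_odd hK hd hodd κ hκ h2le 𝔭₁ hN hunits hxy hbez hbez' hα

end Literature.NumberTheory.IwasawaTheory

end
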